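import Mathlib
import HarnessLib

/-!
# Route FrobeniusLadder — crux `FInjectiveMacaulayfication` (stmt-ResolutionOfSingularities-15315), line `Sketch`, stub `stub_propagation`

The PROPAGATION lemma of the graded Cartier criterion engine (card `graded-cartier-criterion`),
in abstract form. Let `R` be a commutative ring, `p : ℕ`, and `T : R →+ R` an additive map that is
`p⁻¹`-linear, `T (r ^ p * s) = r * T s`. If an ideal `𝔞` satisfies `𝔞 ≤ (T(𝔞 ^ p))`
(surjectivity at level one), then `𝔞 ^ n ≤ (T(𝔞 ^ (p * n)))` for every `n ≥ 1`
(surjectivity propagates to all levels).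

Proof: induction on `n ≥ 1`. The step `n → n + 1` is
`𝔞 ^ (n + 1) = 𝔞 * 𝔞 ^ n ≤ 𝔞 * (T(𝔞 ^ (p * n))) ≤ (T(𝔞 ^ (p + p * n)))`, the last inequality
because `a * T s = T (a ^ p * s)` and `a ^ p * s ∈ 𝔞 ^ p * 𝔞 ^ (p * n) = 𝔞 ^ (p + p * n)`.
Pure commutative algebra over Mathlib; no characteristic assumption on `R` or primality of `p`.
-/

-- single-problem summit: the doubled namespace component is forced
set_option linter.dupNamespace false

namespace Summit.ResolutionOfSingularities.ResolutionOfSingularities.Theorems.FInjectiveMacaulayfication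

/-- One propagation step: for an additive `T : R →+ R` with `T (r ^ p * s) = r * T s` and any
ideal `𝔞`, `𝔞 * (T(𝔞 ^ m)) ≤ (T(𝔞 ^ (p + m)))`; indeed for `a ∈ 𝔞` and `s ∈ 𝔞 ^ m`,
`a * T s = T (a ^ p * s)` with `a ^ p * s ∈ 𝔞 ^ p * 𝔞 ^ m = 𝔞 ^ (p + m)`. -/
theorem ideal_mul_span_image_le {R : Type} [CommRing R] (p : ℕ) (T : R →+ R)
    (hT : ∀ r s : R, T (r ^ p * s) = r * T s) (𝔞 : Ideal R) (m : ℕ) :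
    𝔞 * Ideal.span (T '' ↑(𝔞 ^ m)) ≤ Ideal.span (T '' ↑(𝔞 ^ (p + m))) := by
  rw [Ideal.mul_le]
  intro a ha b hb
  induction hb using Submodule.span_induction with
  | mem x hx =>
    obtain ⟨s, hs, rfl⟩ := hx
    rw [← hT]
    refine Ideal.subset_span ⟨a ^ p * s, ?_, rfl⟩
    rw [SetLike.mem_coe, pow_add]
    exact Ideal.mul_mem_mul (Ideal.pow_mem_pow ha p) hs
  | zero =>
    rw [mul_zero]
    exact Submodule.zero_mem _
  | add x y _ _ hx hy =>
    rw [mul_add]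
    exact Submodule.add_mem _ hx hy
  | smul c x _ hx =>
    rw [smul_eq_mul, mul_left_comm]
    exact Ideal.mul_mem_left _ c hx

/-- PROPAGATION (card `graded-cartier-criterion`, line `Sketch`, stub `stub_propagation` of crux
stmt-ResolutionOfSingularities-15315): for an additive `T : R →+ R` with `T (r ^ p * s) = r * T s`
(`p⁻¹`-linearity) and an ideal `𝔞` with `𝔞 ≤ (T(𝔞 ^ p))`, one has `𝔞 ^ n ≤ (T(𝔞 ^ (p * n)))`
for all `n ≥ 1`: surjectivity at one level propagates. Induction on `n`, the step being
`𝔞 ^ (n + 1) = 𝔞 * 𝔞 ^ n ≤ 𝔞 * (T(𝔞 ^ (p * n))) ≤ (T(𝔞 ^ (p + p * n)))`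
(`ideal_mul_span_image_le`). -/
theorem stub_propagation : ∀ {R : Type} [CommRing R] (p : ℕ) (T : R →+ R),
    (∀ r s : R, T (r ^ p * s) = r * T s) → ∀ 𝔞 : Ideal R, 𝔞 ≤ Ideal.span (T '' ↑(𝔞 ^ p)) →
      ∀ n : ℕ, 1 ≤ n → 𝔞 ^ n ≤ Ideal.span (T '' ↑(𝔞 ^ (p * n))) := by
  intro R _ p T hT 𝔞 h𝔞 n hn
  induction n, hn using Nat.le_induction with
  | base => simpa only [pow_one, mul_one] using h𝔞
  | succ n _ ih =>
    rw [show p * (n + 1) = p + p * n by ring, pow_succ' 𝔞 n]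
    exact (Ideal.mul_mono_right ih).trans (ideal_mul_span_image_le p T hT 𝔞 (p * n))

end Summit.ResolutionOfSingularities.ResolutionOfSingularities.Theorems.FInjectiveMacaulayfication
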